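import Mathlib.Analysis.SpecialFunctions.Log.Basic
import Mathlib.Analysis.SpecialFunctions.Pow.Real
import Mathlib.Analysis.SpecialFunctions.Sqrt
import Literature.Geometry.Lorentzian.RecedingKerrInitialLayerNorm
import Literature.Geometry.Lorentzian.KerrNullFrame
import HarnessLib

/-!
# The Kerr-adapted layer norm of a vacuum region relative to a receding multi-Kerr configuration

Definition request `defn-KerrAdaptedLayerNorm` (route FinalStateConjecture/DerivativeThrift; the
items `ThriftyKerrStability`, `ThriftyClusterSettling`, `ThriftyHandoff`,
`ThriftyMinkowskiStability` are to be restated 1:1 in it). The requester's words: *"Kerr-ADAPTED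
variant of `Spacetime.recedingKerrInitialLayerNorm` (`RecedingKerrInitialLayerNorm.lean`): same
three parts (near `Cᵏ` sup, far `r^p` flux, far transversal flux) but (i) LEAVES asymptotic to the
background outgoing null cones instead of flat hyperboloids: layer time `s = x⁰ − τ − H_ℓ` with a
height function `H` whose derivative tends to the background null slope INCLUDING the tortoise
logarithm (Schwarzschild: `H ∼ r + 4M ln r`; hyperboloidal foliations of Dafermos–Rodnianski
arXiv:0811.0354 / Moschidis), so that leaves reach a cut of `𝓘⁺` rather than `i⁰`; (ii) the `r^p`
and transversal densities taken in the background Kerr–Schild NULL FRAME (outgoing/ingoing null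
directions built from `Kerr.nullVector`, superposed for `N` holes) instead of the flat frame
`∂₀ ± ∂_r`. Parameters `k, p, δ` as before; recommended ranges `1 < p < 2`, `0 < δ < 1`."*

**Why** (the requester's documented defect of the flat version, checked here): in the ingoing
Kerr–Schild chart of Schwarzschild the retarded time is `u = t* − r − 4M log(r − 2M)`
(`t* = t + 2M log(r − 2M)`, `u = t − r*`, Dafermos–Rodnianski arXiv:0811.0354, §2.2 and §5.1), so
the FLAT outgoing vector `L = ∂₀ + ∂_r` has `L u = −4M/(r − 2M)`: for outgoing radiation
`h ≈ F(u)/r` the flat density `r^p |L(r D^m h)|² ≈ 16M² r^{p−2} |F^{(m+1)}(u)|²` is not integrable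
along a leaf for `p ≥ 1`, and the flat hyperboloids `{x⁰ − √(ℓ² + |x̲|²) = c}` have
`u = −4M log r + O(1) → −∞` along them: they end at spacelike infinity `i⁰`, crossing all the
radiation emitted earlier (exactly the erratum recorded for the first hyperboloidal foliation of
`KerrHyperboloidalFlux.lean`). Both defects are of order `M/r` and are cured by building the
background's `M/r` structure into the leaves and into the outgoing frame vector, which is what
this file does; everything else (the three parts, the weights `σ^m`, `r^p`, `r^{−1−δ}`, the
radiation fields `ψ_m = r D^m h̃`, the leaf-averaged measure `d⁴x/(ℓ r²)`, the value in `ℝ≥0∞`)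
is kept verbatim from `RecedingKerrInitialLayerNorm.lean`, whose flat frame
(`Minkowski.radialUnit`, `.rotation`, `.angularGradSq`, `.radiationField`,
`.transversalFluxDensity`), hole radii (`RecedingKerr.holeRadius`) and scale (`RecedingKerr.scale`)
are reused.

## What the sources print (the templates)

* Dafermos–Rodnianski, arXiv:0811.0354, §4 (p. 22 of the arXiv text): "Let `Σ̃₀` be a spacelike
  hypersurface terminating on null infinity and define `Σ̃_τ` by translation" — the foliation of
  the decay statements of §4 and §5.3 (§5.3.5: fluxes `∫_{Σ̃_τ} J^N_μ n^μ`).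
* Moschidis, Ann. PDE 2 (2016), arXiv:1509.08489, §3.1, Def. 3.2 (p. 26): an achronal hypersurface
  `𝒮` *terminates at `𝓘⁺`* iff the retarded coordinate `u` is bounded on `𝒮 ∩ {r ≫ 1}`; and the
  model construction `t̄_{η'} = u − 1/(1 + r^{η'})`, whose level sets are spacelike for `r` large
  (`g^{μν} ∂_μ t̄ ∂_ν t̄ = −2η' r^{−1−η'} + O(r^{−2−a} + r^{−2−η'}) < 0`) and satisfy
  `|t̄ − u| ≤ 1`.
* Dafermos–Rodnianski, arXiv:0910.4957, §3–§4: the `r^p` flux `∫ r^p (∂_v ψ)²` with `∂_v` the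
  OUTGOING NULL derivative of the background; the tree's `Kerr.outVector`
  (`KerrNullFrame.lean`: `m = 2∂_{t*} + (1 − 2H) ℓ♯`, exactly `g`-null, `= (1 + 2M/r)∂_{t*} +
  (1 − 2M/r)∂_r` for `a = 0`) and the ingoing principal null vector `k = −ℓ♯`
  (`Kerr.nullVector`, `KerrSchild.lean`) form that frame in the ingoing Kerr–Schild chart.
* Kerr–Schild 1965: the ansatz `η + 2H ℓ ⊗ ℓ` is Lorentz covariant (`boostedKerrBilin`,
  `KerrConvergence.lean`), and `ℓ♯` is null for BOTH `η` and `g` (`Kerr.nullCovector_nullVector`).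

**No printed formulation of the present notion exists** (`N ≥ 2` moving holes; the route posits
it); as for the flat version, this file assembles the requested norm from the templates, and the
two adaptations are derived below ("Checks") from the Kerr–Schild structure of the reference form.

## Rendering (namespace `Literature.Geometry.Lorentzian`, grouping namespace `KerrAdapted`)

Data exactly as in `RecedingKerrInitialLayerNorm.lean`: `M a : Fin N → ℝ`,
`Λ : Fin N → lorentzGroup`, centres `ξ : Fin N → E3` at lab time `τ`, scale `ℓ`, exponents
`k, p, δ`. For the 1:1 restatement of the route items replace `RecedingKerr.layer`,
`RecedingKerr.layerTime τ ℓ`, `Spacetime.recedingKerrInitialLayerNorm` by `KerrAdapted.layer`,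
`KerrAdapted.layerTime M a Λ ξ τ ℓ`, `Spacetime.kerrAdaptedLayerNorm` (same argument order; the
layer time now depends on the configuration).

(i) **The adapted layer time** `KerrAdapted.layerTime … x = x⁰ − τ − H(x̲)` with the height
`KerrAdapted.height … y = (ρ_ℓ(y) − ℓ) + Σᵢ (Bᵢ(y) − Bᵢ(0))`, `ρ_ℓ(y) = √(ℓ² + |y|²)`
(`KerrAdapted.flatRadius`; the first summand is the flat hyperboloidal height of the old version),
and the **tortoise delay of hole `i`**
`Bᵢ(y) = KerrAdapted.holeDelay … i y = 2 Mᵢ Dᵢ(y) log(1 + rᵢ'(y)²/ℓ²)`, where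
`rᵢ'(y) = RecedingKerr.holeRadius a Λ ξ τ i (flatLeafPoint τ ℓ y)` is the rest-frame Kerr–Schild
radius of hole `i` at the event `(τ + ρ_ℓ(y) − ℓ, y)` where the flat leaf passes over `y` (so the
logarithm is centred on the MOVING hole where the leaf meets it), and
`Dᵢ(y) = KerrAdapted.doppler (Λ i) ℓ y = −η(Λᵢ e₀, K_ℓ(y))`, `K_ℓ(y) = (1, y/ρ_ℓ(y))`
(`KerrAdapted.flatLeafNormal`, the future normal `−η♯ ds_flat` of the flat leaves, tending to the
flat outgoing null vector `(1, ŷ)`), is the Doppler factor `γᵢ(1 − vᵢ·y/ρ_ℓ) → γᵢ(1 − vᵢ·ŷ)` of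
hole `i` in the direction `ŷ`. Far out, `Bᵢ = 4MᵢDᵢ(ŷ) log|y| + O(1)`: for one hole at rest at
the origin `H = ρ_ℓ − ℓ + 4M log(ρ_ℓ/ℓ) ∼ r + 4M log r`, the requested profile
(`height_schwarzschild`); the normalisation `H(0) = 0` (`height_zero`) keeps
`s(x⁰, 0) = x⁰ − τ` (`layerTime_ofTimeSpace_zero`). The layer, near/far parts, background and
leaves are then defined word for word as before: `KerrAdapted.layer = {0 < s < ℓ} ∩ ⋂ᵢ {Mᵢ < rᵢ}`
(`Opens E4`), `nearLayer = layer ∩ {|x̲| ≤ ℓ}`, `farLayer = layer ∩ {ℓ ≤ |x̲|}`,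
`KerrAdapted.background` (domain the layer, reference form the SAME superposed boosted Kerr–Schild
form `G = η + Σᵢ (gᵢ − η)` as `RecedingKerr.background` — `background_bilin` — time function `s`,
radius `|x̲|`). For `N = 0` everything reduces to the flat version (`height_of_isEmpty`,
`layerTime_of_isEmpty`, `layer_of_isEmpty`, `outgoingNull_of_isEmpty`).

(ii) **The adapted outgoing null vector** `KerrAdapted.outgoingNull … x = (e₀ + r̂) − Σᵢ cᵢ(x) ℓ♯ᵢ(x)`,
where `ℓ♯ᵢ(x) = Λᵢ · Kerr.nullVector aᵢ (Λᵢ⁻¹(x − (τ, ξᵢ)))` (`holeNullVector`: hole `i`'s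
Kerr–Schild congruence vector in lab components, null for `η` AND for `gᵢ`), and
`cᵢ = 2Hᵢ / (2(Λᵢe₀)⁰ + (ℓ♯ᵢ)⁰)` (`bendCoeff`, `Hᵢ = holeScalarH`). This is the superposition,
hole by hole, of the **bending** `mᵢ − m♭ᵢ = −2Hᵢ ℓ♯ᵢ` of the rest-frame outgoing null vector
`m = 2e₀ + (1 − 2H)ℓ♯ = Kerr.outVector` relative to the flat null vector `m♭ = 2e₀ + ℓ♯ = (1, ℓ⃗)`
along the same congruence direction, each normalised so that `Λᵢ m♭ᵢ` has unit lab time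
component. For one Schwarzschild hole at rest at the origin it IS the tree's Kerr–Schild frame:
`outgoingNull = Kerr.outVector M 0` and `Minkowski.ingoingNull = −Kerr.nullVector 0 = k`
(`outgoingNull_schwarzschild`, `Minkowski.ingoingNull_eq_neg_nullVector`; for `a ≠ 0` the two
differ from `m`, `k` by the `O(a/r)` twist `(0, x̂ − ℓ⃗)`, immaterial below). The ingoing vectors
`kᵢ = −ℓ♯ᵢ` are null for `η` and `gᵢ` alike, so they carry NO bending and the same recipe returns
the flat transversal vector `L̲ = e₀ − r̂`: the transversal density is `Minkowski.transversalFluxDensity`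
unchanged (first-order misalignments of `L̲` with the individual `kᵢ` only produce bounded factors
under the weight `r^{−1−δ}`; see "Checks" (c)). The adapted `r^p` density is
`KerrAdapted.rpFluxDensity … p ψ x = r^p ‖dψ_x(L')‖² + |∇̸ψ|² + r⁻²‖ψ‖²` (flat rotations `Ω_{ij}`
for `∇̸`, as in DHRT's `r⁻²|r∇̸Ψ|²`, which carries no `r^p` weight).

(a), (b), (c) and the norm: `KerrAdapted.nearCkNorm … k f = scaleCkENorm nearLayer k σ f`
(`σ = RecedingKerr.scale M ℓ`), `KerrAdapted.rpFlux … k p f = Σ_{m ≤ k} σ^{2m} ℓ⁻¹ ∫_{farLayer} r⁻²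
rpFluxDensity p (r D^m f)`, `KerrAdapted.transversalFlux` likewise with the flat transversal
density, and `Spacetime.kerrAdaptedLayerNorm 𝓢 M a Λ ξ τ ℓ k p δ Φ = (a) + (b)^{1/2} + (c)^{1/2}` at
`f = h̃ = 𝓢.deviationExtend (KerrAdapted.background …) Φ`.

## Checks (informal, recorded for the reviewers; `r = |x̲|`, `d = maxᵢ |ξᵢ|`, `h = Σᵢ 2Hᵢ ℓᵢ ⊗ ℓᵢ`)

(a) *The frame reads outgoing radiation correctly.* For the optical function `u_G` of the
reference form `G = η + h` one has, to first order, `L(δu) = −½ h(L, L)` along the flat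
`L = (1, x̂)` (eikonal equation `G⁻¹(du, du) = 0`, `η♯du₀ = −L`). Along the lab direction `x̂`,
hole `i` contributes `hᵢ(L, L) = 2Hᵢ (ℓᵢ(L))² = 2 (Mᵢ/(Dᵢr)) (2Dᵢ)² = 8MᵢDᵢ/r` (rest-frame radius
`r' ≈ Dᵢ r` along the ray, `ℓ(Λᵢ⁻¹L) = Dᵢ ℓ'((1, x̂')) = 2Dᵢ`, `Dᵢ = γᵢ(1 − vᵢ·x̂)` the Doppler
factor), whence `u_G = t − r − 4 Σᵢ MᵢDᵢ(x̂) log r + O(1) = t − r + 4η(P, L) log r + O(1)` with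
`P = Σᵢ Mᵢ Λᵢe₀` the total four-momentum (for one hole at rest: `−4M log r`, the tortoise term).
Each lab-normalised `Λᵢmᵢ` is EXACTLY `gᵢ`-null and equals `L + δᵢ + ρᵢ` with the bending
`δᵢ = O(Mᵢ/r)` and a re-centring `ρᵢ = (0, nᵢ − x̂)` between unit vectors, `η(L, ρᵢ) = cos θᵢ − 1
= O(d²/r²)`; expanding `G(L', L')` for `L' = L + Σᵢ δᵢ` all first-order terms cancel hole by hole:
`G(L', L') = O((M + d)²/r²)`. A vector null to second order and within `O(1/r)` of the generator
differentiates `u_G` only at second order (`X(u_G) = −½ G(X − L_G, X − L_G)` for `G`-null `X`), so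
`L'(r D^m h) = O(r⁻²)` for `h ≈ F(u_G)/r`, and `r^p |L'ψ_m|²` is integrable along the leaves for
every `p < 3` — the intent of check (i) of the flat file, now honest for `1 < p < 2`. The flat
rotations give `Ω_{ij} u_G = O(log r)` (angular dependence of `Dᵢ`), harmless under the weight of
`|∇̸ψ|² = (2r²)⁻¹ Σ |Ω_{ij}ψ|²`.
(b) *The leaves terminate at `𝓘⁺` of the background.* Along the leaf `{s = s₀}` in the direction
`x̂`, `x⁰ = τ + s₀ + r + 4ΣᵢMᵢDᵢ(x̂) log r + O(1)` (`Dᵢ(y) → Dᵢ(x̂)`, `log(1 + rᵢ'²/ℓ²) = 2 log r +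
O(1)` since `rᵢ' ≈ Dᵢ r`), so `u_G` stays bounded: the leaf terminates at `𝓘⁺` in the sense of
Moschidis, Def. 3.2, at a cut `u_G = τ + s₀ − ℓ + O(1)` (the `O(1)` independent of `s₀`), and a
layer of thickness `ℓ` sees only the radiation of a retarded-time window of length `O(ℓ)` (exact
check for one boosted hole: with
`H = r + κ log r`, `t' − r' = (κ/Dᵢ) log r + O(1)` along the leaf, bounded against `4Mᵢ log r'`
iff `κ = 4MᵢDᵢ`). With any other log coefficient `u_G → ∓∞` logarithmically (`i⁰`, resp.
eventually timelike leaves), which is why `H` cannot be radial once a hole moves.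
(c) *Spacelike leaves.* For one Schwarzschild hole at rest at the origin the radial slope of the
leaves is `H' = r/ρ_ℓ + 4Mr/ρ_ℓ² < 1 + 4M/r ≤ (1 + 2H)/(1 − 2H)` (the chart's outgoing null slope,
`H = M/r < ½`), so the lag is positive on the whole exterior and the leaves are spacelike there
(`heightProfile_deriv_lt_nullSlope`; inside `{r ≤ 2M}` every graph of nonnegative slope is), while
the lag `8M²/r² + ℓ²/(2r²) + O(r⁻³)` is integrable ((b) again). In general the lag is
`(ℓ²/2 + 8(ΣMᵢ)² + O(Mᵢ ξᵢ·x̂) + …)/r²`, of Moschidis's borderline order `η' = 1`: positive far out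
when `ℓ² + 16(ΣMᵢ)²` dominates `8ΣMᵢ|ξᵢ|`-type terms, not for every configuration — as for the flat
version, the consumers HYPOTHESISE achronal embedded leaves; nothing here asserts it. The transversal
vector: `G(L̲, L̲) = Σ 2Hᵢ(ℓᵢ(L̲))²` is `O(M/r)` for boosted or off-centre holes (aberration of the
ingoing congruence), which changes `L̲ψ = O(1)·F′` by relative `O(M/r)` only.
(d) *`N = 0`, non-vacuity and exactness.* With no hole all objects are the flat ones (lemmas
`…_of_isEmpty`); the adapted layer of one Kerr hole at rest at the origin contains the leaf points
`(τ + s₀ + H(y), y)`, `0 < s₀ < ℓ`, over every `y` outside the core (`ofTimeSpace_mem_layer_kerr`);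
for an exactly (multi-)Kerr–Schild layer `h̃ = 0` and the norm vanishes (`…_zero` lemmas).

## Junk values and scope (documented, not hidden)

* As before: `0 < ℓ`, `0 < Mᵢ` intended; for `ℓ ≤ 0` the layer is empty (`layer_eq_bot_of_nonpos`);
  for `ℓ = 0` every `holeDelay` is the junk `0` (`x/0 = 0`). `Λᵢ` are meant orthochronous (for a
  time-reversed `Λᵢ` the sign of `Dᵢ` flips). Off `{x̲ ≠ 0}` the flat radial vector is the junk
  `(0, 0)`; on a hole's ring `{rᵢ' = 0}` its `ℓ♯ᵢ`, `Hᵢ` carry the junk of `KerrSchild.lean` (the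
  cores `{rᵢ ≤ Mᵢ}` are excised from the layer, and the far integrals only see `farLayer`).
* Near a hole far from the origin (`|ξᵢ| ≫ ℓ`, the cluster items) the frame is the flat lab frame
  bent by `O(Mᵢ/rᵢ)` radial-from-hole terms, a legitimate but not hole-principal null pair, and the
  weights are those of the origin (`r ≈ |ξᵢ|`); the adaptation is exact for the centred hole
  (`ThriftyKerrStability`) and asymptotic in general ((a), (b)).
* Not here (as before): smoothness/embedding/achronality conditions on `Φ`, any claim that `G` is
  Lorentzian or vacuum, the modulated energy.

## Mathlib / tree

Mathlib: `Real.log`, `Real.sqrt`, `Real.rpow`, `iteratedFDeriv`, `fderiv`, `∫⁻`, `Finset.sum`,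
`TopologicalSpace.Opens`; no null frames or hyperboloidal layers (`lean search
'KerrAdapted|adaptedLayer|heightFunction'`: nothing relevant). Tree: everything of
`RecedingKerrInitialLayerNorm.lean` (flat frame, `holeRadius`, `scale`), `scaleCkENorm`
(`ShellDeviation`), `Kerr.nullVector/scalarH/outVector` and their stationarity
(`KerrSchild`, `KerrSchildCoord`, `KerrNullFrame`), `poincareInv`, `boostedKerrBilin`,
`ModelBackground`, `Spacetime.deviationExtend` (`KerrConvergence`), `Kerr.scriSlope` and the
`i⁰`/`𝓘⁺` dichotomy (`KerrHyperboloidalFlux`, for comparison: `σ♯ = r*' + 2M/r` is the same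
`1 + 4M/r + O(r⁻²)` slope in `t*_KS`).

## References

* M. Dafermos, I. Rodnianski, *Lectures on black holes and linear waves*, Clay Math. Proc. 17
  (2013), arXiv:0811.0354, §2.2 (`t* = t + 2M log(r − 2M)`), §4 p. 22 (`Σ̃_τ` terminating on null
  infinity), §5.1 (Kerr–Schild coordinates), §5.3.5 (key `DafermosRodnianski2008`).
* G. Moschidis, *The `r^p`-weighted energy method of Dafermos and Rodnianski in general
  asymptotically flat spacetimes and applications*, Ann. PDE 2 (2016) 6, arXiv:1509.08489, §3.1,
  Def. 3.2 and the construction `t̄_{η'}` (p. 26) (key `Moschidis2016`).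
* M. Dafermos, I. Rodnianski, *A new physical-space approach to decay for the wave equation with
  applications to black hole spacetimes*, XVIth ICMP (2010) 421–432, arXiv:0910.4957, §3–§4
  (key `DafermosRodnianski2010ICMP`).
* M. Dafermos, G. Holzegel, I. Rodnianski, M. Taylor, *The non-linear stability of the
  Schwarzschild family of black holes*, arXiv:2104.08222, Ch. 8 §1.4 (key `arXiv210408222`).
* S. Klainerman, J. Szeftel, *Kerr stability for small angular momentum*, PAMQ 19 (2023),
  arXiv:2104.11857, §3.1, §3.6 (key `KlainermanSzeftel2023`).
* R. P. Kerr, A. Schild (1965), §2 (key `KerrSchild1965`); M. Visser, arXiv:0706.0622, (32)–(35)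
  (key `arXiv07060622`).
-/

noncomputable section

open TopologicalSpace MeasureTheory
open scoped ContDiff Topology ENNReal Manifold

universe u

namespace Literature.Geometry.Lorentzian

/-! ### Two bookkeeping lemmas on `E4` -/

namespace E4

/-- `(t, 0) = t ∂₀` in `E4`. Coordinate bookkeeping (Dafermos–Rodnianski arXiv:0811.0354, §5.1).
[cite: DafermosRodnianski2008, §5.1] -/
theorem ofTimeSpace_zero_right (t : ℝ) : ofTimeSpace t 0 = t • basisVector 0 := by
  ext μ
  refine Fin.cases ?_ (fun j ↦ ?_) μ
  · simp
  · simp [Fin.succ_ne_zero]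

/-- Joint continuity of `(t, y) ↦ (t, y) ∈ E4` along continuous `t = f(z)`, `y = g(z)`
(`(f z, g z) = (0, g z) + f z ∂₀`). Coordinate bookkeeping (DR arXiv:0811.0354, §5.1).
[cite: DafermosRodnianski2008, §5.1] -/
theorem continuous_ofTimeSpace₂ {X : Type*} [TopologicalSpace X] {f : X → ℝ} {g : X → E3}
    (hf : Continuous f) (hg : Continuous g) : Continuous fun z ↦ ofTimeSpace (f z) (g z) := by
  have h : (fun z ↦ ofTimeSpace (f z) (g z)) = fun z ↦ ofTimeSpace 0 (g z) + f z • basisVector 0 := by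
    funext z
    ext μ
    refine Fin.cases ?_ (fun j ↦ ?_) μ
    · simp
    · simp [Fin.succ_ne_zero]
  rw [h]
  exact ((continuous_ofTimeSpace 0).comp hg).add (hf.smul continuous_const)

end E4

/-! ### The flat frame for Schwarzschild at the origin is the Kerr–Schild null frame -/

namespace Minkowski

/-- For `a = 0` the flat radial unit vector is `∂₀ + ℓ♯`: `(0, x̂) = (1, 0) + (−1, x̲/r)`
(`r = ‖x̲‖ ≠ 0`; `ℓ = (1, x̲/r)` for Schwarzschild, Visser arXiv:0706.0622, (34) with `a = 0`).
[cite: arXiv07060622, (34)] -/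
theorem radialUnit_eq_basisVector_add_nullVector {x : E4} (hx : E4.spatialNorm x ≠ 0) :
    radialUnit x = E4.basisVector 0 + Kerr.nullVector 0 x := by
  have hr : Kerr.radius 0 x = E4.spatialNorm x := Kerr.radius_zero_left x
  ext μ
  refine Fin.cases ?_ (fun j ↦ ?_) μ
  · simp [radialUnit, Kerr.nullVector_apply_zero]
  · have hl : radialUnit x j.succ = (E4.spatialNorm x)⁻¹ * x j.succ := by
      simp [radialUnit, E4.spatial_apply]
    have hrhs : (E4.basisVector 0 + Kerr.nullVector 0 x) j.succ = Kerr.nullCovectorFun 0 x j.succ := by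
      simp [Kerr.nullVector, Fin.succ_ne_zero]
    rw [hl, hrhs]
    have h3 : (2 : Fin 3).succ = (3 : Fin 4) := rfl
    fin_cases j
    · simp [Kerr.nullCovectorFun, hr]
      field_simp
    · simp [Kerr.nullCovectorFun, hr]
      field_simp
    · simp [Kerr.nullCovectorFun, hr, h3]
      field_simp

/-- **The flat transversal vector is the ingoing principal null vector of Schwarzschild**:
`L̲ = ∂₀ − ∂_r = −ℓ♯ = k` in the ingoing Kerr–Schild chart (`a = 0`, off the axis `x̲ = 0`), the
future ingoing null vector of the frame of `KerrNullFrame.lean`; in particular it is exactly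
`g_{M,0}`-null for every `M` (`Kerr.nullCovector_nullVector`). Dafermos–Rodnianski
arXiv:0910.4957, §4 (`∂_u`, `∂_v` on Schwarzschild); Kerr–Schild 1965, §2.
[cite: DafermosRodnianski2010ICMP, §4] -/
theorem ingoingNull_eq_neg_nullVector {x : E4} (hx : E4.spatialNorm x ≠ 0) :
    ingoingNull x = -Kerr.nullVector 0 x := by
  rw [ingoingNull, radialUnit_eq_basisVector_add_nullVector hx]
  abel

end Minkowski

namespace KerrAdapted

variable {N : ℕ} (M a : Fin N → ℝ) (Λ : Fin N → lorentzGroup) (ξ : Fin N → E3) (τ ℓ : ℝ)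

/-! ### (i) The adapted layer time: flat hyperboloidal height plus the holes' tortoise delays -/

/-- The flat hyperboloidal radius `ρ_ℓ(y) = √(ℓ² + ‖y‖²)`; `ρ_ℓ − ℓ` is the height of the flat
hyperboloidal leaves of `RecedingKerr.layerTime` (`s_flat = x⁰ − τ − (ρ_ℓ(x̲) − ℓ)`). Moschidis,
arXiv:1509.08489, §3.1 (hyperboloidal hypersurfaces). [cite: Moschidis2016, §3.1] -/
def flatRadius (ℓ : ℝ) (y : E3) : ℝ :=
  √(ℓ ^ 2 + ‖y‖ ^ 2)

/-- `ρ_ℓ` is continuous. [folklore] -/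
theorem continuous_flatRadius (ℓ : ℝ) : Continuous (flatRadius ℓ) := by
  unfold flatRadius
  fun_prop

/-- `|ℓ| ≤ ρ_ℓ(y)`. [folklore] -/
theorem abs_le_flatRadius (ℓ : ℝ) (y : E3) : |ℓ| ≤ flatRadius ℓ y :=
  Real.abs_le_sqrt (by nlinarith [sq_nonneg ‖y‖])

/-- `‖y‖ ≤ ρ_ℓ(y)`. [folklore] -/
theorem norm_le_flatRadius (ℓ : ℝ) (y : E3) : ‖y‖ ≤ flatRadius ℓ y :=
  (le_abs_self _).trans (Real.abs_le_sqrt (by nlinarith [sq_nonneg ℓ]))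

/-- `ρ_ℓ(y) > 0` as soon as `ℓ ≠ 0`. [folklore] -/
theorem flatRadius_pos {ℓ : ℝ} (hℓ : ℓ ≠ 0) (y : E3) : 0 < flatRadius ℓ y :=
  (abs_pos.2 hℓ).trans_le (abs_le_flatRadius ℓ y)

/-- `ρ_ℓ(0) = ℓ` for `ℓ ≥ 0`. [folklore] -/
@[simp]
theorem flatRadius_zero {ℓ : ℝ} (hℓ : 0 ≤ ℓ) : flatRadius ℓ 0 = ℓ := by
  simp [flatRadius, Real.sqrt_sq hℓ]

/-- The **flat leaf point over `y`**: the event `(τ + ρ_ℓ(y) − ℓ, y)` at which the flat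
hyperboloidal leaf `{s_flat = 0}` of `RecedingKerr.layerTime τ ℓ` passes over the spatial point
`y` — where the holes' rest-frame radii entering the delays are evaluated (so that each logarithm
is centred on the moving hole where the leaf meets it). DR arXiv:0811.0354, §4 p. 22 (`Σ̃_τ` by
translation of `Σ̃₀`). [cite: DafermosRodnianski2008, §4 p. 22] -/
def flatLeafPoint (τ ℓ : ℝ) (y : E3) : E4 :=
  E4.ofTimeSpace (τ + (flatRadius ℓ y - ℓ)) y

/-- The flat leaf point depends continuously on `y`. [folklore] -/
theorem continuous_flatLeafPoint (τ ℓ : ℝ) : Continuous (flatLeafPoint τ ℓ) :=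
  E4.continuous_ofTimeSpace₂ (continuous_const.add ((continuous_flatRadius ℓ).sub continuous_const))
    continuous_id

/-- The flat leaf point over the origin is `(τ, 0)` (`ℓ ≥ 0`). [folklore] -/
@[simp]
theorem flatLeafPoint_zero {ℓ : ℝ} (hℓ : 0 ≤ ℓ) : flatLeafPoint τ ℓ 0 = E4.ofTimeSpace τ 0 := by
  simp [flatLeafPoint, flatRadius_zero hℓ]

/-- The **future normal of the flat leaves** `K_ℓ(y) = −η♯ ds_flat = (1, y/ρ_ℓ(y))`: future
timelike, tending to the flat outgoing null vector `(1, ŷ)` as `|y| → ∞` (junk `(1, 0)` only for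
`ℓ = 0, y = 0`). Moschidis arXiv:1509.08489, §3.1 (the gradient of the hyperboloidal time
function). [cite: Moschidis2016, §3.1] -/
def flatLeafNormal (ℓ : ℝ) (y : E3) : E4 :=
  E4.ofTimeSpace 1 ((flatRadius ℓ y)⁻¹ • y)

/-- `K_ℓ` is continuous in `y` (`ℓ ≠ 0`). [folklore] -/
theorem continuous_flatLeafNormal {ℓ : ℝ} (hℓ : ℓ ≠ 0) : Continuous (flatLeafNormal ℓ) :=
  E4.continuous_ofTimeSpace₂ continuous_const
    (((continuous_flatRadius ℓ).inv₀ fun y ↦ (flatRadius_pos hℓ y).ne').smul continuous_id)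

/-- `K_ℓ(0) = ∂₀`. [folklore] -/
@[simp]
theorem flatLeafNormal_zero (ℓ : ℝ) : flatLeafNormal ℓ 0 = E4.basisVector 0 := by
  rw [flatLeafNormal, smul_zero, E4.ofTimeSpace_zero_right, one_smul]

/-- The **Doppler factor** of the motion `Λ` in the direction of `y`:
`D(y) = −η(Λ e₀, K_ℓ(y)) = γ (1 − v · y/ρ_ℓ(y))` for `Λ e₀ = γ(1, v)` (the energy, in the rest frame
of the hole, of the future normal of the flat leaf; `→ γ(1 − v·ŷ)`, the red-shift factor of lab
photons emitted along `ŷ`). For `Λ = 1`, `D = 1` (`doppler_one`). O'Neill 1983, Ch. 9 (Lorentz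
boosts); folklore special relativity. [folklore] -/
def doppler (Λ : lorentzGroup) (ℓ : ℝ) (y : E3) : ℝ :=
  -Minkowski.bilin ((Λ : E4 ≃L[ℝ] E4) (E4.basisVector 0)) (flatLeafNormal ℓ y)

/-- The Doppler factor is continuous in `y` (`ℓ ≠ 0`). [folklore] -/
theorem continuous_doppler (Λ : lorentzGroup) {ℓ : ℝ} (hℓ : ℓ ≠ 0) : Continuous (doppler Λ ℓ) :=
  ((Minkowski.bilin ((Λ : E4 ≃L[ℝ] E4) (E4.basisVector 0))).continuous.comp
    (continuous_flatLeafNormal hℓ)).neg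

/-- For the trivial motion the Doppler factor is `1` (`−η(e₀, K) = K⁰ = 1`). [folklore] -/
@[simp]
theorem doppler_one (ℓ : ℝ) (y : E3) : doppler 1 ℓ y = 1 := by
  have h : ((1 : lorentzGroup) : E4 ≃L[ℝ] E4) (E4.basisVector 0) = E4.basisVector 0 := rfl
  rw [doppler, h, Minkowski.bilin_basisVector_zero_left]
  simp [flatLeafNormal]

/-- The **tortoise delay of hole `i`** over `y`:
`Bᵢ(y) = 2 Mᵢ Dᵢ(y) log(1 + rᵢ'(y)²/ℓ²)`, `rᵢ'(y)` the rest-frame Kerr–Schild radius of hole `i` at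
the flat leaf point over `y` (`RecedingKerr.holeRadius`), `Dᵢ` its Doppler factor: a smoothing,
flat on the scale `ℓ` near the hole, of the lab-time delay `4MᵢDᵢ log rᵢ'` by which the outgoing
null cones of the boosted hole lag behind the flat cones (rest frame: `u = t* − r − 4M log(r − 2M)`,
i.e. `t* = u + r + 4M log(r − 2M)` along the cones, Dafermos–Rodnianski arXiv:0811.0354, §2.2 with
§5.1; the factor `Dᵢ` converts rest-frame retarded time to lab retarded time, module docstring,
Checks (a)–(b)). Junk `0` for `ℓ = 0`. [cite: DafermosRodnianski2008, §2.2 and §5.1] -/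
def holeDelay (i : Fin N) (y : E3) : ℝ :=
  2 * M i * doppler (Λ i) ℓ y *
    Real.log (1 + RecedingKerr.holeRadius a Λ ξ τ i (flatLeafPoint τ ℓ y) ^ 2 / ℓ ^ 2)

/-- The argument of the logarithm is `≥ 1`. [folklore] -/
theorem one_le_holeDelay_arg (i : Fin N) (y : E3) :
    1 ≤ 1 + RecedingKerr.holeRadius a Λ ξ τ i (flatLeafPoint τ ℓ y) ^ 2 / ℓ ^ 2 :=
  le_add_of_nonneg_right (div_nonneg (sq_nonneg _) (sq_nonneg _))

/-- Each delay is continuous in `y` (`ℓ ≠ 0`). [folklore] -/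
theorem continuous_holeDelay {ℓ : ℝ} (hℓ : ℓ ≠ 0) (i : Fin N) :
    Continuous (holeDelay M a Λ ξ τ ℓ i) := by
  unfold holeDelay
  refine ((continuous_const.mul (continuous_doppler (Λ i) hℓ)).mul ?_)
  refine Continuous.log ?_ fun y ↦ (lt_of_lt_of_le one_pos (one_le_holeDelay_arg a Λ ξ τ ℓ i y)).ne'
  exact continuous_const.add ((((RecedingKerr.continuous_holeRadius a Λ ξ τ i).comp
    (continuous_flatLeafPoint τ ℓ)).pow 2).div_const _)

/-- For `ℓ = 0` every delay is the junk value `0` (`x/0 = 0`, `log 1 = 0`). [folklore] -/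
@[simp]
theorem holeDelay_zero_scale (i : Fin N) (y : E3) : holeDelay M a Λ ξ τ 0 i y = 0 := by
  simp [holeDelay]

/-- The **adapted height function** `H(y) = (ρ_ℓ(y) − ℓ) + Σᵢ (Bᵢ(y) − Bᵢ(0))`: the flat
hyperboloidal height plus the holes' tortoise delays, normalised by `H(0) = 0`. Far out in the
direction `ŷ`, `H = |y| + 4 (Σᵢ MᵢDᵢ(ŷ)) log|y| + O(1)`, the lab-time height of the outgoing null
cones of the reference form `G` (module docstring, Checks (a)–(b)); for one hole at rest at the
origin `H = ρ_ℓ − ℓ + 4M log(ρ_ℓ/ℓ) ∼ r + 4M log r` (`height_schwarzschild`), the tortoise-corrected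
hyperboloid of the request, cf. `Kerr.scriSlope = r*' + 2M/r` (`KerrHyperboloidalFlux.lean`, the
same `t*_KS`-slope `1 + 4M/r + O(r⁻²)`). Template: the hyperboloidal time functions `t̄` with
`|t̄ − u|` bounded of Moschidis, arXiv:1509.08489, §3.1 (Def. 3.2 and `t̄_{η'}`), and `Σ̃_τ` of
Dafermos–Rodnianski arXiv:0811.0354, §4. [cite: Moschidis2016, §3.1 Def. 3.2] -/
def height (y : E3) : ℝ :=
  (flatRadius ℓ y - ℓ) + ∑ i, (holeDelay M a Λ ξ τ ℓ i y - holeDelay M a Λ ξ τ ℓ i 0)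

/-- The height function is continuous on `E3` (for every `ℓ`: for `ℓ = 0` the delays vanish).
[folklore] -/
theorem continuous_height : Continuous (height M a Λ ξ τ ℓ) := by
  by_cases hℓ : ℓ = 0
  · subst hℓ
    unfold height
    simp only [holeDelay_zero_scale, sub_self, Finset.sum_const_zero, add_zero, sub_zero]
    exact continuous_flatRadius 0
  · unfold height
    exact ((continuous_flatRadius ℓ).sub continuous_const).add
      (continuous_finsetSum _ fun i _ ↦ (continuous_holeDelay M a Λ ξ τ hℓ i).sub continuous_const)

/-- Normalisation `H(0) = 0` (`ℓ ≥ 0`). [folklore] -/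
@[simp]
theorem height_zero {ℓ : ℝ} (hℓ : 0 ≤ ℓ) : height M a Λ ξ τ ℓ 0 = 0 := by
  simp [height, flatRadius_zero hℓ]

/-- With no hole the height is the flat hyperboloidal one, `√(ℓ² + ‖y‖²) − ℓ`. Moschidis
arXiv:1509.08489, §3.1. [cite: Moschidis2016, §3.1] -/
@[simp]
theorem height_of_isEmpty [IsEmpty (Fin N)] (y : E3) :
    height M a Λ ξ τ ℓ y = √(ℓ ^ 2 + ‖y‖ ^ 2) - ℓ := by
  simp [height, flatRadius]

/-- The **Kerr-adapted layer time** `s(x) = x⁰ − τ − H(x̲)`: its level sets `{s = s₀}` are the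
`x⁰`-translates of the graph of the adapted height `H`, asymptotic to the outgoing null cones of the
reference form and terminating at `𝓘⁺` (module docstring (i) and Checks (b)); `s(x⁰, 0) = x⁰ − τ`.
Replaces `RecedingKerr.layerTime τ ℓ` (flat hyperboloids, which reach `i⁰` in a massive
background). Dafermos–Rodnianski arXiv:0811.0354, §4 p. 22 (`Σ̃_τ`); Moschidis arXiv:1509.08489,
§3.1. [cite: DafermosRodnianski2008, §4 p. 22] -/
def layerTime (x : E4) : ℝ :=
  x 0 - τ - height M a Λ ξ τ ℓ (E4.spatial x)

/-- The layer time is continuous on `E4`. [folklore] -/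
theorem continuous_layerTime : Continuous (layerTime M a Λ ξ τ ℓ) := by
  unfold layerTime
  exact ((PiLp.continuous_apply 2 _ (0 : Fin 4)).sub continuous_const).sub
    ((continuous_height M a Λ ξ τ ℓ).comp E4.spatial.continuous)

/-- On the time axis through the origin, `s(x⁰, 0) = x⁰ − τ` (`ℓ ≥ 0`). DR arXiv:0811.0354, §4.
[cite: DafermosRodnianski2008, §4] -/
@[simp]
theorem layerTime_ofTimeSpace_zero (t : ℝ) {ℓ : ℝ} (hℓ : 0 ≤ ℓ) :
    layerTime M a Λ ξ τ ℓ (E4.ofTimeSpace t 0) = t - τ := by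
  simp [layerTime, height_zero M a Λ ξ τ hℓ]

/-- With no hole the adapted layer time is the flat one of `RecedingKerrInitialLayerNorm.lean`.
Moschidis arXiv:1509.08489, §3.1. [cite: Moschidis2016, §3.1] -/
theorem layerTime_of_isEmpty [IsEmpty (Fin N)] :
    layerTime M a Λ ξ τ ℓ = RecedingKerr.layerTime τ ℓ := by
  funext x
  simp [layerTime, RecedingKerr.layerTime, E4.spatialNorm]

/-! ### The adapted layer, its parts, and the reference background -/

/-- The **Kerr-adapted initial layer** `𝓛 = {x ∈ E4 | 0 < s(x) < ℓ} ∩ ⋂ᵢ {Mᵢ < rᵢ(x)}` of the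
receding multi-Kerr configuration at lab time `τ` and scale `ℓ`, an open subset of `E4`: the shell
of layer-time thickness `ℓ` above the adapted leaf `{s = 0}` through `(τ, 0)`, minus the cores
`{rᵢ ≤ Mᵢ}` (`rᵢ = RecedingKerr.holeRadius`, `Mᵢ = (r₊ + r₋)/2`). Word for word
`RecedingKerr.layer` with the adapted layer time; template: the initial data layer
`𝓛₀ = 𝓛_ext ∪ 𝓛_int` of Klainerman–Szeftel, arXiv:2104.11857, §3.1. Empty when `ℓ ≤ 0`
(`layer_eq_bot_of_nonpos`). [cite: KlainermanSzeftel2023, §3.1 (initial data layer)] -/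
def layer : Opens E4 :=
  ⟨(layerTime M a Λ ξ τ ℓ ⁻¹' Set.Ioo 0 ℓ) ∩ ⋂ i, {x | M i < RecedingKerr.holeRadius a Λ ξ τ i x},
    ((continuous_layerTime M a Λ ξ τ ℓ).isOpen_preimage _ isOpen_Ioo).inter
      (isOpen_iInter_of_finite fun i ↦
        isOpen_lt continuous_const (RecedingKerr.continuous_holeRadius a Λ ξ τ i))⟩

/-- Membership in the adapted layer: `0 < s(x) < ℓ` and `Mᵢ < rᵢ(x)` for all `i`.
Klainerman–Szeftel, arXiv:2104.11857, §3.1. [cite: KlainermanSzeftel2023, §3.1] -/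
@[simp]
theorem mem_layer {x : E4} :
    x ∈ layer M a Λ ξ τ ℓ ↔
      (0 < layerTime M a Λ ξ τ ℓ x ∧ layerTime M a Λ ξ τ ℓ x < ℓ) ∧
        ∀ i, M i < RecedingKerr.holeRadius a Λ ξ τ i x := by
  simp [layer, Set.mem_iInter]

/-- Anti-vacuity flag: for `ℓ ≤ 0` the adapted layer is empty — consumers quantify `0 < ℓ`.
Klainerman–Szeftel, arXiv:2104.11857, §3.1. [cite: KlainermanSzeftel2023, §3.1] -/
theorem layer_eq_bot_of_nonpos (hℓ : ℓ ≤ 0) : layer M a Λ ξ τ ℓ = ⊥ := by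
  refine le_bot_iff.1 fun x hx ↦ ?_
  have h := (mem_layer M a Λ ξ τ ℓ).1 hx
  exact ((not_lt.2 hℓ) (h.1.1.trans h.1.2)).elim

/-- Non-vacuity: with no hole (`N = 0`) and `0 < ℓ`, the point `(τ + ℓ/2, 0)` lies in the layer.
Klainerman–Szeftel, arXiv:2104.11857, §3.1. [cite: KlainermanSzeftel2023, §3.1] -/
theorem ofTimeSpace_mem_layer_of_isEmpty [IsEmpty (Fin N)] (hℓ : 0 < ℓ) :
    E4.ofTimeSpace (τ + ℓ / 2) 0 ∈ layer M a Λ ξ τ ℓ := by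
  rw [mem_layer, layerTime_ofTimeSpace_zero M a Λ ξ τ _ hℓ.le]
  exact ⟨⟨by linarith, by linarith⟩, fun i ↦ isEmptyElim i⟩

/-- With no hole the adapted layer is the flat layer of `RecedingKerrInitialLayerNorm.lean`.
Klainerman–Szeftel, arXiv:2104.11857, §3.1. [cite: KlainermanSzeftel2023, §3.1] -/
theorem layer_of_isEmpty [IsEmpty (Fin N)] : layer M a Λ ξ τ ℓ = RecedingKerr.layer M a Λ ξ τ ℓ := by
  ext x
  simp [layerTime_of_isEmpty]

/-- The **reference background of the adapted layer**: domain the adapted layer, reference form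
the superposed boosted Kerr–Schild ansatz `G(x) = η + Σᵢ (boostedKerrBilin Λᵢ (τ, ξᵢ) Mᵢ aᵢ x − η)`
(the same form as `RecedingKerr.background`, `background_bilin`), time function the ADAPTED layer
time `s` (so `timeSlab s₀` is the adapted leaf `{s = s₀}`), radius `|x̲|`. Kerr–Schild 1965
(Lorentz covariance); the `N`-hole skeleton of the final state picture (folklore; no printed
formulation). [folklore] -/
def background : ModelBackground where
  domain := layer M a Λ ξ τ ℓ
  bilin x := Minkowski.bilin +
    ∑ i, (boostedKerrBilin (Λ i) (E4.ofTimeSpace τ (ξ i)) (M i) (a i) x - Minkowski.bilin)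
  time := layerTime M a Λ ξ τ ℓ
  radius := E4.spatialNorm

/-- The domain of the adapted background is the adapted layer (by `rfl`). [folklore] -/
@[simp]
theorem background_domain : (background M a Λ ξ τ ℓ).domain = layer M a Λ ξ τ ℓ := rfl

/-- The reference form is unchanged: it is that of `RecedingKerr.background` (by `rfl`).
Kerr–Schild 1965. [cite: KerrSchild1965, §2] -/
theorem background_bilin :
    (background M a Λ ξ τ ℓ).bilin = (RecedingKerr.background M a Λ ξ τ ℓ).bilin := rfl

/-- The time slabs of the adapted background are the adapted leaves `{x ∈ 𝓛 | s(x) = s₀}`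
(terminating at `𝓘⁺`, Moschidis arXiv:1509.08489, Def. 3.2; module docstring, Checks (b)).
[cite: Moschidis2016, §3.1 Def. 3.2] -/
theorem mem_timeSlab_background {s₀ : ℝ} {x : (background M a Λ ξ τ ℓ).domain} :
    x ∈ (background M a Λ ξ τ ℓ).timeSlab s₀ ↔ layerTime M a Λ ξ τ ℓ x.1 = s₀ :=
  Iff.rfl

/-- The **near part** `𝓛 ∩ {|x̲| ≤ ℓ}` of the adapted layer (where the `Cᵏ` sup norm (a) is
taken). Klainerman–Szeftel, arXiv:2104.11857, §3.1 (`𝓛_int`). [cite: KlainermanSzeftel2023, §3.1 (𝓛_int)] -/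
def nearLayer : Set E4 :=
  {x | x ∈ layer M a Λ ξ τ ℓ ∧ E4.spatialNorm x ≤ ℓ}

/-- The **far (outgoing) part** `𝓛 ∩ {ℓ ≤ |x̲|}` of the adapted layer (where the fluxes (b), (c)
are taken). Klainerman–Szeftel, arXiv:2104.11857, §3.1 (`𝓛_ext`). [cite: KlainermanSzeftel2023, §3.1 (𝓛_ext)] -/
def farLayer : Set E4 :=
  {x | x ∈ layer M a Λ ξ τ ℓ ∧ ℓ ≤ E4.spatialNorm x}

/-- The layer is the union of its near and far parts. KS arXiv:2104.11857, §3.1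
(`𝓛₀ = 𝓛_ext ∪ 𝓛_int`). [cite: KlainermanSzeftel2023, §3.1] -/
theorem nearLayer_union_farLayer :
    nearLayer M a Λ ξ τ ℓ ∪ farLayer M a Λ ξ τ ℓ = (layer M a Λ ξ τ ℓ : Set E4) := by
  ext x
  simp only [nearLayer, farLayer, Set.mem_union, Set.mem_setOf_eq, SetLike.mem_coe]
  constructor
  · rintro (h | h) <;> exact h.1
  · intro h
    rcases le_total (E4.spatialNorm x) ℓ with h' | h'
    exacts [Or.inl ⟨h, h'⟩, Or.inr ⟨h, h'⟩]

/-- On the far part the spatial radius is at least `ℓ`. KS arXiv:2104.11857, §3.1.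
[cite: KlainermanSzeftel2023, §3.1] -/
theorem le_spatialNorm_of_mem_farLayer {x : E4} (hx : x ∈ farLayer M a Λ ξ τ ℓ) :
    ℓ ≤ E4.spatialNorm x :=
  hx.2

/-! ### (ii) The adapted outgoing null vector: superposed Kerr–Schild bending -/

/-- Rest-frame coordinates `Λᵢ⁻¹(x − (τ, ξᵢ))` of the lab point `x` for hole `i`
(`poincareInv`; `RecedingKerr.holeRadius a Λ ξ τ i x = Kerr.radius aᵢ (restCoord … i x)` by `rfl`).
O'Neill 1983, Ch. 9, p. 236 (Poincaré maps). [folklore] -/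
def restCoord (i : Fin N) (x : E4) : E4 :=
  poincareInv (Λ i) (E4.ofTimeSpace τ (ξ i)) x

/-- `RecedingKerr.holeRadius` is the Kerr–Schild radius of the rest-frame coordinates (`rfl`).
[folklore] -/
theorem holeRadius_eq (i : Fin N) (x : E4) :
    RecedingKerr.holeRadius a Λ ξ τ i x = Kerr.radius (a i) (restCoord Λ ξ τ i x) := rfl

/-- **Hole `i`'s Kerr–Schild congruence vector in lab components**:
`ℓ♯ᵢ(x) = Λᵢ · ℓ♯_{aᵢ}(Λᵢ⁻¹(x − (τ, ξᵢ)))` (`Kerr.nullVector` pushed forward by the boost). It is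
null for `η` (Lorentz invariance) AND for the boosted form `gᵢ = boostedKerrBilin Λᵢ (τ, ξᵢ) Mᵢ aᵢ`
(`gᵢ(x)(Λv, Λw) = g(x')(v, w)` and `Kerr.nullCovector_nullVector`); `kᵢ = −ℓ♯ᵢ` is the future
ingoing principal null vector of hole `i`. Kerr–Schild 1965, §2. [cite: KerrSchild1965, §2] -/
def holeNullVector (i : Fin N) (x : E4) : E4 :=
  (Λ i : E4 ≃L[ℝ] E4) (Kerr.nullVector (a i) (restCoord Λ ξ τ i x))

/-- **Hole `i`'s Kerr–Schild scalar** `Hᵢ(x) = H_{Mᵢ,aᵢ}(Λᵢ⁻¹(x − (τ, ξᵢ)))` (so that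
`gᵢ = η + 2Hᵢ ℓᵢ ⊗ ℓᵢ`). Kerr–Schild 1965, §2; Visser arXiv:0706.0622, (33). [cite: arXiv07060622, (33)] -/
def holeScalarH (i : Fin N) (x : E4) : ℝ :=
  Kerr.scalarH (M i) (a i) (restCoord Λ ξ τ i x)

/-- The **bending coefficient** `cᵢ(x) = 2Hᵢ(x) / (2(Λᵢe₀)⁰ + (ℓ♯ᵢ(x))⁰)` of hole `i`: in the rest
frame the outgoing null vector of the Kerr–Schild chart is `m = 2e₀ + (1 − 2H)ℓ♯ = m♭ − 2Hℓ♯`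
(`Kerr.outVector`, `KerrNullFrame.lean`) with `m♭ = 2e₀ + ℓ♯ = (1, ℓ⃗)` the FLAT null vector
along the same direction, so the gravitational bending of the outgoing direction is `−2Hℓ♯`; the
denominator `(Λᵢ m♭ᵢ)⁰` normalises hole `i`'s contribution to unit lab time component of `Λᵢm♭ᵢ`
(`= 1` for `Λᵢ = 1`; `→ 1/Dᵢ` far out). Dafermos–Rodnianski arXiv:0910.4957, §4 (`∂_v` on
Schwarzschild) with Kerr–Schild 1965 (covariance); module docstring (ii). [cite: DafermosRodnianski2010ICMP, §4] -/
def bendCoeff (i : Fin N) (x : E4) : ℝ :=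
  2 * holeScalarH M a Λ ξ τ i x /
    (2 * (Λ i : E4 ≃L[ℝ] E4) (E4.basisVector 0) 0 + holeNullVector a Λ ξ τ i x 0)

/-- The **Kerr-adapted outgoing null vector** `L'(x) = (∂₀ + ∂_r) − Σᵢ cᵢ(x) ℓ♯ᵢ(x)`: the flat
outgoing vector `Minkowski.outgoingNull` corrected by the superposed Kerr–Schild bendings of the
holes. For one Schwarzschild hole at rest at the origin it is EXACTLY `Kerr.outVector M 0`
(`outgoingNull_schwarzschild`); with no hole it is the flat vector (`outgoingNull_of_isEmpty`); in
general it is `G`-null to second order far out and reads outgoing radiation of the reference form at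
`O(r⁻²)` (module docstring, Checks (a)). Dafermos–Rodnianski arXiv:0910.4957, §3–§4 (the good
derivative `∂_v`); Kerr–Schild 1965. [cite: DafermosRodnianski2010ICMP, §4] -/
def outgoingNull (x : E4) : E4 :=
  Minkowski.outgoingNull x - ∑ i, bendCoeff M a Λ ξ τ i x • holeNullVector a Λ ξ τ i x

/-- With no hole the adapted outgoing vector is the flat one `∂₀ + ∂_r`. DR arXiv:0910.4957, §3.
[cite: DafermosRodnianski2010ICMP, §3] -/
@[simp]
theorem outgoingNull_of_isEmpty [IsEmpty (Fin N)] (x : E4) :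
    outgoingNull M a Λ ξ τ x = Minkowski.outgoingNull x := by
  simp [outgoingNull]

/-- Rest-frame coordinates for the trivial motion through `(τ, 0)` are a time translate:
`x − (τ, 0) = x + (−τ)∂₀`. [folklore] -/
theorem restCoord_one_zero (τ : ℝ) (i : Fin N) (x : E4) :
    restCoord (fun _ : Fin N ↦ (1 : lorentzGroup)) (fun _ ↦ (0 : E3)) τ i x =
      x + (-τ) • E4.basisVector 0 := by
  simp only [restCoord, poincareInv, OneMemClass.coe_one, E4.ofTimeSpace_zero_right, neg_smul,
    ← sub_eq_add_neg]
  rfl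

/-- **For one Schwarzschild hole at rest at the origin the adapted outgoing vector is the
Kerr–Schild outgoing null vector `m = (1 + 2M/r)∂_{t*} + (1 − 2M/r)∂_r`** of `KerrNullFrame.lean`
(off the axis `x̲ = 0`; any mass `M₀`, any epoch `τ`): `(∂₀ + ∂_r) − 2H ℓ♯ = 2∂₀ + (1 − 2H)ℓ♯`
because `∂_r = ∂₀ + ℓ♯` for `a = 0`. In particular `L'` is exactly `g_{M₀,0}`-null there
(`Kerr.bilin_outVector_outVector`). Dafermos–Rodnianski arXiv:0910.4957, §4. [cite: DafermosRodnianski2010ICMP, §4] -/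
theorem outgoingNull_schwarzschild (M₀ τ : ℝ) {x : E4} (hx : E4.spatialNorm x ≠ 0) :
    outgoingNull (fun _ : Fin 1 ↦ M₀) (fun _ ↦ 0) (fun _ ↦ (1 : lorentzGroup)) (fun _ ↦ (0 : E3)) τ x =
      Kerr.outVector M₀ 0 x := by
  have hℓ : Kerr.nullVector 0 (x + (-τ) • E4.basisVector 0) = Kerr.nullVector 0 x :=
    Kerr.nullVector_add_smul_basisVector_zero 0 x (-τ)
  have hH : Kerr.scalarH M₀ 0 (x + (-τ) • E4.basisVector 0) = Kerr.scalarH M₀ 0 x :=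
    Kerr.scalarH_add_smul_basisVector_zero M₀ 0 x (-τ)
  simp only [outgoingNull, bendCoeff, holeScalarH, holeNullVector, restCoord_one_zero,
    Fin.sum_univ_one, OneMemClass.coe_one, hℓ, hH]
  rw [Minkowski.outgoingNull, Minkowski.radialUnit_eq_basisVector_add_nullVector hx, Kerr.outVector]
  have h1 : ((1 : E4 ≃L[ℝ] E4) (E4.basisVector 0)) 0 = 1 := by
    change (E4.basisVector 0) 0 = 1
    simp
  have h2 : (1 : E4 ≃L[ℝ] E4) (Kerr.nullVector 0 x) = Kerr.nullVector 0 x := rfl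
  rw [h1, h2, Kerr.nullVector_apply_zero]
  norm_num
  module

variable {G : Type*} [NormedAddCommGroup G] [NormedSpace ℝ G]

/-- The **Kerr-adapted `r^p` good-derivative flux density** of `ψ : E4 → G` at `x`, in the
DR/DHRT measure `dv dω` (to be integrated against `r⁻² ×` coordinate volume):
`r^p ‖dψ_x(L')‖² + |∇̸ψ|²(x) + r⁻²‖ψ(x)‖²` with the ADAPTED outgoing vector `L' = outgoingNull`,
the flat angular gradient (`Minkowski.angularGradSq`) and `r = |x̲|`. Word for word
`Minkowski.rpFluxDensity` with `L'` for `L`. Dafermos–Rodnianski arXiv:0910.4957, §3–§4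
(`∫ r^p (∂_vψ)²`, `∂_v` the outgoing null derivative of the background); DHRT arXiv:2104.08222,
Ch. 8 §1.4 (`r^p|Ω∇̸₄Ψ|² + r⁻²|r∇̸Ψ|²`). [cite: DafermosRodnianski2010ICMP, §3–§4] -/
def rpFluxDensity (p : ℝ) (ψ : E4 → G) (x : E4) : ℝ :=
  E4.spatialNorm x ^ p * ‖fderiv ℝ ψ x (outgoingNull M a Λ ξ τ x)‖ ^ 2 +
    Minkowski.angularGradSq ψ x + (E4.spatialNorm x ^ 2)⁻¹ * ‖ψ x‖ ^ 2

/-- The adapted `r^p` density is nonnegative. DR arXiv:0910.4957, §3. [cite: DafermosRodnianski2010ICMP, §3] -/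
theorem rpFluxDensity_nonneg (p : ℝ) (ψ : E4 → G) (x : E4) :
    0 ≤ rpFluxDensity M a Λ ξ τ p ψ x :=
  add_nonneg (add_nonneg (mul_nonneg (Real.rpow_nonneg (E4.spatialNorm_nonneg x) _) (sq_nonneg _))
    (Minkowski.angularGradSq_nonneg ψ x)) (mul_nonneg (inv_nonneg.2 (sq_nonneg _)) (sq_nonneg _))

/-- The adapted `r^p` density of `ψ = 0` vanishes. DR arXiv:0910.4957, §3. [cite: DafermosRodnianski2010ICMP, §3] -/
@[simp]
theorem rpFluxDensity_zero (p : ℝ) (x : E4) : rpFluxDensity M a Λ ξ τ p (0 : E4 → G) x = 0 := by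
  simp [rpFluxDensity]

/-- With no hole the adapted density is the flat one of `RecedingKerrInitialLayerNorm.lean`.
DR arXiv:0910.4957, §3. [cite: DafermosRodnianski2010ICMP, §3] -/
@[simp]
theorem rpFluxDensity_of_isEmpty [IsEmpty (Fin N)] (p : ℝ) (ψ : E4 → G) (x : E4) :
    rpFluxDensity M a Λ ξ τ p ψ x = Minkowski.rpFluxDensity p ψ x := by
  simp [rpFluxDensity, Minkowski.rpFluxDensity]

/-! ### The three parts of the norm -/

/-- (a) The **near `Cᵏ` norm** `Σ_{m ≤ k} σ^m · sup_{x ∈ 𝓛, |x̲| ≤ ℓ} ‖D^m f(x)‖ ∈ [0, ∞]` over the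
near part of the ADAPTED layer, `σ = RecedingKerr.scale M ℓ = min(ℓ, minᵢ Mᵢ)`: the generic scaled
`Cᵏ` norm `scaleCkENorm` (`ShellDeviation`), as for `RecedingKerr.nearCkNorm`. Template: the
`sup_{𝓛_int}` part of the initial layer norm `ℑ_k` of Klainerman–Szeftel, arXiv:2104.11857, §3.6.
[cite: KlainermanSzeftel2023, §3.6 (initial layer norm, 𝓛_int part)] -/
def nearCkNorm (k : ℕ) (f : E4 → G) : ℝ≥0∞ :=
  scaleCkENorm (nearLayer M a Λ ξ τ ℓ) k (RecedingKerr.scale M ℓ) f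

/-- (b) The **Kerr-adapted `r^p`-weighted good-derivative flux** of `f : E4 → G` through the far
part of the adapted layer: `Σ_{m ≤ k} σ^{2m} ℓ⁻¹ ∫_{x ∈ 𝓛, ℓ ≤ |x̲|} r⁻² (r^p ‖L'ψ_m‖² + |∇̸ψ_m|² +
r⁻²‖ψ_m‖²) d⁴x ∈ [0, ∞]`, `ψ_m = r • D^m f`, with the ADAPTED outgoing vector `L'`; the factor
`r⁻²/ℓ` makes it the average over the adapted leaves `{s = s₀}`, `0 < s₀ < ℓ`, of the leaf fluxes in
the DR/DHRT measure `dv dω` (graph leaves: `d⁴x = ds r² dr dω`, unit Jacobian, as before).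
Dafermos–Rodnianski arXiv:0910.4957, §3–§4; DHRT arXiv:2104.08222, Ch. 8 §1.4 (`𝔼^{K,p}[P_{𝓘⁺}]`,
commuted with `𝔇^k`). [cite: DafermosRodnianski2010ICMP, §3–§4] -/
def rpFlux (k : ℕ) (p : ℝ) (f : E4 → G) : ℝ≥0∞ :=
  ∑ m ∈ Finset.range (k + 1), ENNReal.ofReal (RecedingKerr.scale M ℓ ^ (2 * m)) *
    ENNReal.ofReal ℓ⁻¹ *
    ∫⁻ x in farLayer M a Λ ξ τ ℓ, ENNReal.ofReal ((E4.spatialNorm x ^ 2)⁻¹ *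
      rpFluxDensity M a Λ ξ τ p (Minkowski.radiationField (iteratedFDeriv ℝ m f)) x)

/-- (c) The **transversal energy flux** of `f : E4 → G` through the far part of the ADAPTED layer:
`Σ_{m ≤ k} σ^{2m} ℓ⁻¹ ∫_{x ∈ 𝓛, ℓ ≤ |x̲|} r⁻² · r^{−1−δ} ‖L̲ψ_m‖² d⁴x ∈ [0, ∞]`, `ψ_m = r • D^m f`,
with the transversal vector `L̲ = ∂₀ − ∂_r`, which IS the (superposed) Kerr–Schild ingoing null
vector: `−ℓ♯` is null for `η` and `g` alike, so its bending correction vanishes, and for the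
Schwarzschild hole at the origin `L̲ = −Kerr.nullVector 0 = k` exactly
(`Minkowski.ingoingNull_eq_neg_nullVector`); module docstring (ii), Checks (c). DHRT
arXiv:2104.08222, Ch. 8 §1.4 (the term `r^{−1−δ}|Ω∇̸₃𝔇^kΨ|²`). [cite: arXiv210408222, Ch. 8 §1.4] -/
def transversalFlux (k : ℕ) (δ : ℝ) (f : E4 → G) : ℝ≥0∞ :=
  ∑ m ∈ Finset.range (k + 1), ENNReal.ofReal (RecedingKerr.scale M ℓ ^ (2 * m)) *
    ENNReal.ofReal ℓ⁻¹ *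
    ∫⁻ x in farLayer M a Λ ξ τ ℓ, ENNReal.ofReal ((E4.spatialNorm x ^ 2)⁻¹ *
      Minkowski.transversalFluxDensity δ (Minkowski.radiationField (iteratedFDeriv ℝ m f)) x)

/-- Bridge: the near norm (a) is `scaleCkENorm` over the near adapted layer (by `rfl`), so its API
applies verbatim. KS arXiv:2104.11857, §3.6. [cite: KlainermanSzeftel2023, §3.6] -/
theorem nearCkNorm_eq_scaleCkENorm (k : ℕ) (f : E4 → G) :
    nearCkNorm M a Λ ξ τ ℓ k f =
      scaleCkENorm (nearLayer M a Λ ξ τ ℓ) k (RecedingKerr.scale M ℓ) f :=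
  rfl

/-- The near norm of `f = 0` vanishes. KS arXiv:2104.11857, §3.6. [cite: KlainermanSzeftel2023, §3.6] -/
@[simp]
theorem nearCkNorm_zero (k : ℕ) : nearCkNorm M a Λ ξ τ ℓ k (0 : E4 → G) = 0 :=
  scaleCkENorm_zero _ _ _

/-- The adapted `r^p` flux of `f = 0` vanishes (exact configurations have vanishing flux).
DR arXiv:0910.4957, §3. [cite: DafermosRodnianski2010ICMP, §3] -/
@[simp]
theorem rpFlux_zero (k : ℕ) (p : ℝ) : rpFlux M a Λ ξ τ ℓ k p (0 : E4 → G) = 0 := by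
  simp [rpFlux]

/-- The transversal flux of `f = 0` vanishes. DHRT arXiv:2104.08222, Ch. 8 §1.4. [cite: arXiv210408222, Ch. 8 §1.4] -/
@[simp]
theorem transversalFlux_zero (k : ℕ) (δ : ℝ) :
    transversalFlux M a Λ ξ τ ℓ k δ (0 : E4 → G) = 0 := by
  simp [transversalFlux]

/-- The near norm is monotone in the number of derivatives. KS arXiv:2104.11857, §3.6.
[cite: KlainermanSzeftel2023, §3.6] -/
theorem nearCkNorm_mono {k k' : ℕ} (h : k ≤ k') (f : E4 → G) :
    nearCkNorm M a Λ ξ τ ℓ k f ≤ nearCkNorm M a Λ ξ τ ℓ k' f :=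
  scaleCkENorm_mono_right _ h _ _

/-- The adapted `r^p` flux is monotone in the number of derivatives. DHRT arXiv:2104.08222,
Ch. 8 §1.4. [cite: arXiv210408222, Ch. 8 §1.4] -/
theorem rpFlux_mono {k k' : ℕ} (h : k ≤ k') (p : ℝ) (f : E4 → G) :
    rpFlux M a Λ ξ τ ℓ k p f ≤ rpFlux M a Λ ξ τ ℓ k' p f :=
  Finset.sum_le_sum_of_subset (Finset.range_mono (Nat.succ_le_succ h))

/-- The transversal flux is monotone in the number of derivatives. DHRT arXiv:2104.08222,
Ch. 8 §1.4. [cite: arXiv210408222, Ch. 8 §1.4] -/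
theorem transversalFlux_mono {k k' : ℕ} (h : k ≤ k') (δ : ℝ) (f : E4 → G) :
    transversalFlux M a Λ ξ τ ℓ k δ f ≤ transversalFlux M a Λ ξ τ ℓ k' δ f :=
  Finset.sum_le_sum_of_subset (Finset.range_mono (Nat.succ_le_succ h))

/-- Pointwise reading of a near-norm bound: `σ^m ‖D^m f(x)‖ ≤ nearCkNorm … k f` for `m ≤ k` and
`x` in the near adapted layer. KS arXiv:2104.11857, §3.6. [cite: KlainermanSzeftel2023, §3.6] -/
theorem ofReal_mul_enorm_iteratedFDeriv_le_nearCkNorm {k m : ℕ} (hm : m ≤ k) {x : E4}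
    (hx : x ∈ nearLayer M a Λ ξ τ ℓ) (f : E4 → G) :
    ENNReal.ofReal (RecedingKerr.scale M ℓ ^ m) * ‖iteratedFDeriv ℝ m f x‖ₑ ≤
      nearCkNorm M a Λ ξ τ ℓ k f :=
  ofReal_mul_enorm_iteratedFDeriv_le_scaleCkENorm hm hx _ f

/-- Exactness: if `f` vanishes on an open neighbourhood of the near adapted layer, its near `Cᵏ`
norm is `0`. KS arXiv:2104.11857, §3.6. [cite: KlainermanSzeftel2023, §3.6] -/
theorem nearCkNorm_eq_zero_of_eqOn {V : Set E4} (hV : IsOpen V)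
    (hsub : nearLayer M a Λ ξ τ ℓ ⊆ V) {f : E4 → G} (hf : Set.EqOn f 0 V) (k : ℕ) :
    nearCkNorm M a Λ ξ τ ℓ k f = 0 :=
  scaleCkENorm_eq_zero_of_eqOn hV hsub hf k _

end KerrAdapted

/-! ### The norm -/

namespace Spacetime

variable (𝓢 : Spacetime.{u} 4) {N : ℕ} (M a : Fin N → ℝ) (Λ : Fin N → lorentzGroup)
  (ξ : Fin N → E3) (τ ℓ : ℝ)

/-- The **Kerr-adapted layer norm** `𝔑'(Φ) ∈ [0, ∞]` of a chart `Φ : 𝓛 → 𝓢.carrier` of the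
spacetime `𝓢` on the adapted layer `𝓛 = KerrAdapted.layer M a Λ ξ τ ℓ` of the configuration
`(Mᵢ, aᵢ, Λᵢ, ξᵢ)` at lab time `τ` and scale `ℓ`, with exponents `(k, p, δ)`: writing
`h̃ = deviationExtend` of `Φ^* g − G` (`G` the superposed boosted Kerr–Schild form of
`KerrAdapted.background`),
`𝔑'(Φ) = nearCkNorm k h̃ + (rpFlux k p h̃)^{1/2} + (transversalFlux k δ h̃)^{1/2}` — (a) the near
`Cᵏ` sup norm, (b) the leaf-averaged `r^p`-weighted ADAPTED good-derivative flux and (c) the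
transversal flux of `ψ_m = r D^m h̃`, `m ≤ k`, through the far part of the adapted layer, whose
leaves follow the outgoing null cones of the background to a cut of `𝓘⁺` (module docstring).
The Kerr-adapted variant of `Spacetime.recedingKerrInitialLayerNorm` requested by route
FinalStateConjecture/DerivativeThrift (no printed formulation for `N ≥ 2`); recommended exponents
`1 < p < 2`, `0 < δ < 1`; intended for `0 < ℓ` and smooth open embeddings `Φ`. Templates:
Dafermos–Rodnianski arXiv:0910.4957, §3–§4; DHRT arXiv:2104.08222, Ch. 8 §1.4; Klainerman–Szeftel
arXiv:2104.11857, §3.6; Moschidis arXiv:1509.08489, §3.1; DR arXiv:0811.0354, §4.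
[cite: DafermosRodnianski2010ICMP, §3–§4] [cite: Moschidis2016, §3.1 Def. 3.2]
[cite: KlainermanSzeftel2023, §3.6] -/
def kerrAdaptedLayerNorm (k : ℕ) (p δ : ℝ)
    (Φ : KerrAdapted.layer M a Λ ξ τ ℓ → 𝓢.carrier) : ℝ≥0∞ :=
  KerrAdapted.nearCkNorm M a Λ ξ τ ℓ k
      (𝓢.deviationExtend (KerrAdapted.background M a Λ ξ τ ℓ) Φ) +
    KerrAdapted.rpFlux M a Λ ξ τ ℓ k p
        (𝓢.deviationExtend (KerrAdapted.background M a Λ ξ τ ℓ) Φ) ^ (1 / 2 : ℝ) +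
      KerrAdapted.transversalFlux M a Λ ξ τ ℓ k δ
          (𝓢.deviationExtend (KerrAdapted.background M a Λ ξ τ ℓ) Φ) ^ (1 / 2 : ℝ)

/-- Unfolding lemma: `𝔑' = (a) + (b)^{1/2} + (c)^{1/2}` at `h̃ = deviationExtend (background …) Φ`.
DR arXiv:0910.4957, §3–§4. [cite: DafermosRodnianski2010ICMP, §3–§4] -/
theorem kerrAdaptedLayerNorm_eq (k : ℕ) (p δ : ℝ)
    (Φ : KerrAdapted.layer M a Λ ξ τ ℓ → 𝓢.carrier) :
    𝓢.kerrAdaptedLayerNorm M a Λ ξ τ ℓ k p δ Φ =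
      KerrAdapted.nearCkNorm M a Λ ξ τ ℓ k
          (𝓢.deviationExtend (KerrAdapted.background M a Λ ξ τ ℓ) Φ) +
        KerrAdapted.rpFlux M a Λ ξ τ ℓ k p
            (𝓢.deviationExtend (KerrAdapted.background M a Λ ξ τ ℓ) Φ) ^ (1 / 2 : ℝ) +
          KerrAdapted.transversalFlux M a Λ ξ τ ℓ k δ
              (𝓢.deviationExtend (KerrAdapted.background M a Λ ξ τ ℓ) Φ) ^ (1 / 2 : ℝ) :=
  rfl

/-- (a) the near `Cᵏ` norm is dominated by the norm. KS arXiv:2104.11857, §3.6.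
[cite: KlainermanSzeftel2023, §3.6] -/
theorem nearCkNorm_le_kerrAdaptedLayerNorm (k : ℕ) (p δ : ℝ)
    (Φ : KerrAdapted.layer M a Λ ξ τ ℓ → 𝓢.carrier) :
    KerrAdapted.nearCkNorm M a Λ ξ τ ℓ k
        (𝓢.deviationExtend (KerrAdapted.background M a Λ ξ τ ℓ) Φ) ≤
      𝓢.kerrAdaptedLayerNorm M a Λ ξ τ ℓ k p δ Φ :=
  le_add_right le_self_add

/-- (b) the square root of the adapted `r^p` flux is dominated by the norm. DR arXiv:0910.4957,
§3. [cite: DafermosRodnianski2010ICMP, §3] -/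
theorem rpFlux_rpow_le_kerrAdaptedLayerNorm (k : ℕ) (p δ : ℝ)
    (Φ : KerrAdapted.layer M a Λ ξ τ ℓ → 𝓢.carrier) :
    KerrAdapted.rpFlux M a Λ ξ τ ℓ k p
        (𝓢.deviationExtend (KerrAdapted.background M a Λ ξ τ ℓ) Φ) ^ (1 / 2 : ℝ) ≤
      𝓢.kerrAdaptedLayerNorm M a Λ ξ τ ℓ k p δ Φ :=
  le_add_right le_add_self

/-- (c) the square root of the transversal flux is dominated by the norm. DHRT arXiv:2104.08222,
Ch. 8 §1.4. [cite: arXiv210408222, Ch. 8 §1.4] -/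
theorem transversalFlux_rpow_le_kerrAdaptedLayerNorm (k : ℕ) (p δ : ℝ)
    (Φ : KerrAdapted.layer M a Λ ξ τ ℓ → 𝓢.carrier) :
    KerrAdapted.transversalFlux M a Λ ξ τ ℓ k δ
        (𝓢.deviationExtend (KerrAdapted.background M a Λ ξ τ ℓ) Φ) ^ (1 / 2 : ℝ) ≤
      𝓢.kerrAdaptedLayerNorm M a Λ ξ τ ℓ k p δ Φ :=
  le_add_self

/-- The norm is monotone in the number of derivatives `k`. DHRT arXiv:2104.08222, Ch. 8 §1.4.
[cite: arXiv210408222, Ch. 8 §1.4] -/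
theorem kerrAdaptedLayerNorm_mono {k k' : ℕ} (h : k ≤ k') (p δ : ℝ)
    (Φ : KerrAdapted.layer M a Λ ξ τ ℓ → 𝓢.carrier) :
    𝓢.kerrAdaptedLayerNorm M a Λ ξ τ ℓ k p δ Φ ≤ 𝓢.kerrAdaptedLayerNorm M a Λ ξ τ ℓ k' p δ Φ := by
  unfold kerrAdaptedLayerNorm
  gcongr
  · exact KerrAdapted.nearCkNorm_mono M a Λ ξ τ ℓ h _
  · exact KerrAdapted.rpFlux_mono M a Λ ξ τ ℓ h p _
  · exact KerrAdapted.transversalFlux_mono M a Λ ξ τ ℓ h δ _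

/-- Smallness of the norm controls the pointwise near-zone derivatives: for `m ≤ k` and `x` in the
near part of the adapted layer, `σ^m ‖D^m h̃(x)‖ ≤ 𝔑'(Φ)`. KS arXiv:2104.11857, §3.6.
[cite: KlainermanSzeftel2023, §3.6] -/
theorem ofReal_mul_enorm_iteratedFDeriv_le_kerrAdaptedLayerNorm {k m : ℕ} (hm : m ≤ k)
    (p δ : ℝ) (Φ : KerrAdapted.layer M a Λ ξ τ ℓ → 𝓢.carrier) {x : E4}
    (hx : x ∈ KerrAdapted.nearLayer M a Λ ξ τ ℓ) :
    ENNReal.ofReal (RecedingKerr.scale M ℓ ^ m) *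
        ‖iteratedFDeriv ℝ m (𝓢.deviationExtend (KerrAdapted.background M a Λ ξ τ ℓ) Φ) x‖ₑ ≤
      𝓢.kerrAdaptedLayerNorm M a Λ ξ τ ℓ k p δ Φ :=
  (KerrAdapted.ofReal_mul_enorm_iteratedFDeriv_le_nearCkNorm M a Λ ξ τ ℓ hm hx _).trans
    (𝓢.nearCkNorm_le_kerrAdaptedLayerNorm M a Λ ξ τ ℓ k p δ Φ)

end Spacetime

/-! ### The Schwarzschild hole at rest at the origin: the requested profile, spacelike leaves -/

namespace KerrAdapted

/-- **The adapted height for one Schwarzschild hole of mass `M₀` at rest at the origin** is the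
tortoise-corrected hyperboloid `H(y) = (√(ℓ² + ‖y‖²) − ℓ) + 2M₀ log(1 + ‖y‖²/ℓ²)
= ρ_ℓ − ℓ + 4M₀ log(ρ_ℓ/ℓ) ∼ r + 4M₀ log r` (meaningful for `ℓ > 0`): the profile `H ∼ r + 4M ln r` of the
request (the leaves `{t*_KS = c + H}` follow `t* = u + r + 4M log(r − 2M)`, Dafermos–Rodnianski
arXiv:0811.0354, §2.2 with §5.1, up to `O(1)`). [cite: DafermosRodnianski2008, §2.2 and §5.1] -/
theorem height_schwarzschild (M₀ τ ℓ : ℝ) (y : E3) :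
    height (fun _ : Fin 1 ↦ M₀) (fun _ ↦ 0) (fun _ ↦ (1 : lorentzGroup)) (fun _ ↦ (0 : E3)) τ ℓ y =
      (√(ℓ ^ 2 + ‖y‖ ^ 2) - ℓ) + 2 * M₀ * Real.log (1 + ‖y‖ ^ 2 / ℓ ^ 2) := by
  have hr : ∀ z : E3, RecedingKerr.holeRadius (fun _ : Fin 1 ↦ (0 : ℝ)) (fun _ ↦ (1 : lorentzGroup))
      (fun _ ↦ (0 : E3)) τ 0 (flatLeafPoint τ ℓ z) = ‖z‖ := by
    intro z
    rw [holeRadius_eq, restCoord_one_zero, Kerr.radius_add_time_smul_basisVector,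
      Kerr.radius_zero_left, flatLeafPoint, E4.spatialNorm_ofTimeSpace]
  simp [height, holeDelay, flatRadius, hr]

/-- **Non-vacuity of the adapted layer of one Kerr hole at rest at the origin** (the layer of
the route's `ThriftyKerrStability`): for `0 < s₀ < ℓ` and every spatial point `y` outside the
excised core (`M₀ < r(0, y)`), the point `(τ + s₀ + H(y), y)` of the adapted leaf `{s = s₀}` over
`y` lies in the layer. Klainerman–Szeftel, arXiv:2104.11857, §3.1 (the initial data layer is a
non-empty spacetime region). [cite: KlainermanSzeftel2023, §3.1] -/
theorem ofTimeSpace_mem_layer_kerr (M₀ a₀ τ : ℝ) {ℓ s₀ : ℝ} (hs : s₀ ∈ Set.Ioo 0 ℓ) {y : E3}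
    (hy : M₀ < Kerr.radius a₀ (E4.ofTimeSpace 0 y)) :
    E4.ofTimeSpace (τ + s₀ + height (fun _ : Fin 1 ↦ M₀) (fun _ ↦ a₀)
        (fun _ ↦ (1 : lorentzGroup)) (fun _ ↦ (0 : E3)) τ ℓ y) y ∈
      layer (fun _ : Fin 1 ↦ M₀) (fun _ ↦ a₀) (fun _ ↦ (1 : lorentzGroup)) (fun _ ↦ (0 : E3)) τ ℓ := by
  rw [mem_layer]
  refine ⟨?_, fun i ↦ ?_⟩
  · simp only [layerTime, E4.ofTimeSpace_apply_zero, E4.spatial_ofTimeSpace]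
    constructor <;> linarith [hs.1, hs.2]
  · rw [holeRadius_eq, restCoord_one_zero, Kerr.radius_add_time_smul_basisVector,
      Kerr.radius_ofTimeSpace]
    exact hy

/-- The **radial height profile** `r ↦ (√(ℓ² + r²) − ℓ) + 2M₀ log(1 + r²/ℓ²)` of the centred
Schwarzschild hole (`height_schwarzschild` with `r = ‖y‖`). DR arXiv:0811.0354, §2.2 with §5.1.
[cite: DafermosRodnianski2008, §2.2 and §5.1] -/
def heightProfile (ℓ M₀ r : ℝ) : ℝ :=
  (√(ℓ ^ 2 + r ^ 2) - ℓ) + 2 * M₀ * Real.log (1 + r ^ 2 / ℓ ^ 2)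

/-- The height of the centred Schwarzschild hole is the radial profile of `‖y‖`. [folklore] -/
theorem height_schwarzschild_eq_heightProfile (M₀ τ ℓ : ℝ) (y : E3) :
    height (fun _ : Fin 1 ↦ M₀) (fun _ ↦ 0) (fun _ ↦ (1 : lorentzGroup)) (fun _ ↦ (0 : E3)) τ ℓ y =
      heightProfile ℓ M₀ ‖y‖ :=
  height_schwarzschild M₀ τ ℓ y

/-- The **slope of the adapted leaves of the centred Schwarzschild hole**:
`H'(r) = r/√(ℓ² + r²) + 4M₀ r/(ℓ² + r²)` (`ℓ > 0`): it tends to the outgoing null `t*_KS`-slope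
`1 + 4M₀/r + O(r⁻²)` including the tortoise term (compare `Kerr.scriSlope`). DR arXiv:0811.0354,
§2.2 with §5.1. [cite: DafermosRodnianski2008, §2.2 and §5.1] -/
theorem hasDerivAt_heightProfile {ℓ : ℝ} (hℓ : 0 < ℓ) (M₀ r : ℝ) :
    HasDerivAt (heightProfile ℓ M₀)
      (r / √(ℓ ^ 2 + r ^ 2) + 4 * M₀ * r / (ℓ ^ 2 + r ^ 2)) r := by
  have hℓ0 : ℓ ≠ 0 := hℓ.ne'
  have hρ : 0 < ℓ ^ 2 + r ^ 2 := by positivity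
  have hρ0 : ℓ ^ 2 + r ^ 2 ≠ 0 := hρ.ne'
  have h2r : ((2 : ℕ) : ℝ) * r ^ (2 - 1) = 2 * r := by norm_num
  have h1 : HasDerivAt (fun r : ℝ ↦ √(ℓ ^ 2 + r ^ 2) - ℓ) (r / √(ℓ ^ 2 + r ^ 2)) r := by
    refine ((((hasDerivAt_pow 2 r).const_add (ℓ ^ 2)).sqrt hρ0).sub_const ℓ).congr_deriv ?_
    rw [h2r]
    exact mul_div_mul_left r (√(ℓ ^ 2 + r ^ 2)) two_ne_zero
  have h2 : HasDerivAt (fun r : ℝ ↦ 2 * M₀ * Real.log (1 + r ^ 2 / ℓ ^ 2))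
      (4 * M₀ * r / (ℓ ^ 2 + r ^ 2)) r := by
    have harg : 0 < 1 + r ^ 2 / ℓ ^ 2 := by positivity
    have harg0 : 1 + r ^ 2 / ℓ ^ 2 ≠ 0 := harg.ne'
    refine (((((hasDerivAt_pow 2 r).div_const (ℓ ^ 2)).const_add 1).log harg0).const_mul
      (2 * M₀)).congr_deriv ?_
    rw [h2r]
    field_simp
    ring
  exact h1.add h2

/-- **The adapted leaves of the centred Schwarzschild hole are spacelike on the whole exterior**
(radial criterion): for `r > 2M₀ ≥ 0` and `ℓ > 0` the leaf slope `H'(r)` is STRICTLY below the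
outgoing null `t*_KS`-slope `(1 + 2M₀/r)/(1 − 2M₀/r) = (1 + 2H)/(1 − 2H)` of the chart
(`H' < 1 + 4M₀/r ≤ (1 + 2H)/(1 − 2H)`; for `a = 0` the graph `t* = c + H(r)` is spacelike at `x`
iff `H' < (1 + 2H)/(1 − 2H)`, the quadratic form of its tangent vectors being `|w_⊥|² +
(x̂·w)²(1 + H')((1 − H') + 2H(1 + H'))`), so the lag behind the cones is positive — and it is
`O(r⁻²)`, integrable: the leaves terminate at `𝓘⁺` (Moschidis arXiv:1509.08489, Def. 3.2), unlike
the flat hyperboloids (`H' < 1`, lag `4M₀/r + O(r⁻²)`, `u → −∞`). [cite: Moschidis2016, §3.1 Def. 3.2] -/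
theorem heightProfile_deriv_lt_nullSlope {ℓ M₀ r : ℝ} (hℓ : 0 < ℓ) (hM : 0 ≤ M₀) (hr : 2 * M₀ < r) :
    r / √(ℓ ^ 2 + r ^ 2) + 4 * M₀ * r / (ℓ ^ 2 + r ^ 2) <
      (1 + 2 * M₀ / r) / (1 - 2 * M₀ / r) := by
  have hr0 : 0 < r := lt_of_le_of_lt (by positivity) hr
  have hρ2 : 0 < ℓ ^ 2 + r ^ 2 := by positivity
  have hρ : r < √(ℓ ^ 2 + r ^ 2) := by
    rw [Real.lt_sqrt hr0.le]
    nlinarith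
  have hsqrt_pos : 0 < √(ℓ ^ 2 + r ^ 2) := hr0.trans hρ
  have h1 : r / √(ℓ ^ 2 + r ^ 2) < 1 := (div_lt_one hsqrt_pos).2 hρ
  have h2 : 4 * M₀ * r / (ℓ ^ 2 + r ^ 2) ≤ 4 * M₀ / r := by
    rw [div_le_div_iff₀ hρ2 hr0]
    nlinarith [sq_nonneg ℓ]
  have h3 : 1 + 4 * M₀ / r ≤ (1 + 2 * M₀ / r) / (1 - 2 * M₀ / r) := by
    have hlt : 2 * M₀ / r < 1 := (div_lt_one hr0).2 hr
    rw [le_div_iff₀ (by linarith)]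
    have h0 : 0 ≤ 2 * M₀ / r := by positivity
    have hsq : 0 ≤ (2 * M₀ / r) * (2 * M₀ / r) := mul_nonneg h0 h0
    have hB : 4 * M₀ / r = 2 * (2 * M₀ / r) := by ring
    rw [hB]
    nlinarith
  linarith

end KerrAdapted

end Literature.Geometry.Lorentzian

end
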